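import Literature.Algebra.Polynomial.BernoulliEulerAppell
import Mathlib.Tactic
import HarnessLib

/-!
# The Euler–Maclaurin and Boole summation formulas for polynomials from the Second Expansion Theorem (Rota–Kahaner–Odlyzko §13)

G.-C. Rota, D. Kahaner, A. Odlyzko, *Finite operator calculus* (1973), §13, pp. 737–738:

> By far the most widely studied class of Appell polynomials are the Bernoulli polynomials … They
> correspond to the operator `J^α`, where `J p (x) = ∫_x^{x+1} p (t) dt`. (Since `D J = Δ`, …
> `J = (e^D − 1)/D`.) For `α = 1`, we have `J^{−1} xⁿ = B_n (x)`, the familiar Bernoulli polynomials,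
> whose elementary property can be gleaned from Section 5. The second expansion theorem yields the
> Euler–MacLaurin sum formula; …
> Another extensively studied (by Nörlund) class of Appell polynomials is `E_n^{(a)} (x) = [I + (Δ/2)]^{−a} xⁿ`
> … These sequences are variously called "Euler polynomials," … The second expansion theorem applied
> to the Euler polynomials yields the Boole summation formula.

and §5 Theorem 6 (Second Expansion Theorem), p. 699: `p (x + y) = Σ_{k≥0} s_k (y)/k! · Qᵏ S p (x)`
for the Sheffer set `s_n = S⁻¹ q_n` of `Q`, `S`.

This file carries out the two derivations announced there, for polynomials over a field `K` of
characteristic `0` (where both formulas are EXACT finite identities):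

* `J = (e^D − 1)/D = diffOp (bernoulliPowerSeries K)⁻¹` acts as `J F′ = F (x+1) − F (x)`
  (`diffOp_bernoulliPowerSeries_inv_derivative`: "`J p (x) = ∫_x^{x+1} p (t) dt`" for `p = F′`);
  `J⁻¹ = Σ_k B_k Dᵏ/k!` (`diffOp_bernoulliPowerSeries_apply`); the Second Expansion Theorem for
  `Q = D`, `S⁻¹ = J` (tree: `IsShefferSequence.taylor_map_eq_sum`):
  `f (x + y) = Σ_k B_k (x)/k! · (Dᵏ J f)(y)` (`taylor_eq_sum_bernoulli`, `eval_add_eq_sum_bernoulli`);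
  at `x = 0` the **Euler–Maclaurin formula** `f = J f + Σ_{k≥1} B_k/k! · D^{k−1} Δ f`
  (`eq_sum_bernoulli_smul_iterate_derivative`, `eulerMaclaurin_one_step`, `eulerMaclaurin_eval`) and,
  summed over `x = 0, 1, …, m − 1`, the **Euler–Maclaurin sum formula for polynomials**
  `Σ_{i<m} f (i) = F (m) − F (0) + Σ_{k≥1} B_k/k! (f^{(k−1)} (m) − f^{(k−1)} (0))`, `F′ = f`,
  `B_1 = −1/2` (`eulerMaclaurin_sum_range`);
* `M = I + Δ/2 = ½ (e^D + I)` acts as `(M f)(y) = ½ (f (y) + f (y+1))`, `E_n = M⁻¹ xⁿ`; the Second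
  Expansion Theorem for `Q = D`, `S = M` is **Boole's formula**
  `f (x + y) = Σ_k E_k (x)/k! · ½ (f^{(k)} (y) + f^{(k)} (y+1))` (`taylor_eq_sum_eulerPolynomial`,
  `eval_add_eq_sum_eulerPolynomial`), and its alternating sum over `y = 0, …, m − 1` telescopes to the
  **Boole summation formula for polynomials**
  `Σ_{i<m} (−1)^i f (i) = ½ Σ_k E_k (0)/k! · (f^{(k)} (0) − (−1)^m f^{(k)} (m))` (`boole_sum_range`).

Dictionary: `diffOp φ = φ(D)`, `taylor y = E^y`, `bernoulliPowerSeries K = Σ B_k tᵏ/k! = t/(e^t − 1)`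
(Mathlib, `B_1 = −1/2`), `(Polynomial.bernoulli n).map (algebraMap ℚ K) = B_n (x) = J⁻¹ xⁿ`
(`bernoulli_map_eq_diffOp_X_pow`), `eulerPolynomial K n = E_n = 2 (e^D + I)⁻¹ xⁿ` (`eulerPolynomial_eq`),
all from `BernoulliEulerAppell`. Nearest existing declarations (different statements, not imported): the
ANALYTIC Euler–Maclaurin formula with remainder for real `C^k` functions
(`Literature.Analysis.Quadrature.EulerMaclaurinTrapezoidal.sum_Ioc_eq_eulerMaclaurin_fin`,
`Literature.NumberTheory.LFunctions.EulerMaclaurinZetaHigher`), Mathlib's Faulhaber formula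
`sum_range_pow` (the case `f = xᵖ` of `eulerMaclaurin_sum_range`); no Boole summation in the tree.

## References
* [RotaKahanerOdlyzko1973] G.-C. Rota, D. Kahaner, A. Odlyzko, *On the foundations of
  combinatorial theory VIII. Finite operator calculus*, J. Math. Anal. Appl. 42 (1973) 684–760,
  §5 Theorem 6, p. 699; §13, pp. 737–738.
-/

noncomputable section

open Polynomial Finset

namespace Literature.Algebra.Polynomial

variable (K : Type*) [Field K] [CharZero K]

/-! ## The Bernoulli operator `J = (e^D − 1)/D`: `J p (x) = ∫_x^{x+1} p (t) dt` -/

/-- **`J F′ = F (x + 1) − F (x)`** — the operator `J = (e^D − 1)/D` is "`J p (x) = ∫_x^{x+1} p (t) dt`"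
(stated on `p = F′`, which is every polynomial in characteristic `0`).
[cite: RotaKahanerOdlyzko1973, §13 ("`J p (x) = ∫_x^{x+1} p (t) dt` … since `D J = Δ`"), p. 737] -/
theorem diffOp_bernoulliPowerSeries_inv_derivative (F : K[X]) :
    diffOp (bernoulliPowerSeries K)⁻¹ (derivative F) = taylor (1 : K) F - F := by
  rw [← derivative_diffOp, ← LinearMap.comp_apply, derivative_comp_diffOp_bernoulliPowerSeries_inv,
    LinearMap.sub_apply, LinearMap.id_apply]

/-- `(J F′)(y) = F (y + 1) − F (y)`. [cite: RotaKahanerOdlyzko1973, §13, p. 737] -/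
theorem diffOp_bernoulliPowerSeries_inv_derivative_eval (F : K[X]) (y : K) :
    (diffOp (bernoulliPowerSeries K)⁻¹ (derivative F)).eval y = F.eval (y + 1) - F.eval y := by
  rw [diffOp_bernoulliPowerSeries_inv_derivative, eval_sub, taylor_eval]

/-- **`D J = Δ`** on a polynomial: `(J f)′ = f (x + 1) − f (x)`.
[cite: RotaKahanerOdlyzko1973, §13 ("since `D J = Δ`"), p. 737] -/
theorem derivative_diffOp_bernoulliPowerSeries_inv (f : K[X]) :
    derivative (diffOp (bernoulliPowerSeries K)⁻¹ f) = taylor (1 : K) f - f := by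
  rw [derivative_diffOp, diffOp_bernoulliPowerSeries_inv_derivative]

/-- `Dᵏ⁺¹ J f = Dᵏ (f (x+1) − f (x))`. [cite: RotaKahanerOdlyzko1973, §13, p. 737] -/
theorem iterate_derivative_succ_diffOp_bernoulliPowerSeries_inv (f : K[X]) (k : ℕ) :
    derivative^[k + 1] (diffOp (bernoulliPowerSeries K)⁻¹ f) = derivative^[k] (taylor (1 : K) f - f) := by
  rw [Function.iterate_succ_apply, derivative_diffOp_bernoulliPowerSeries_inv]

omit [CharZero K] in
/-- `(Dᵏ (f (x+1) − f (x)))(y) = f^{(k)} (y + 1) − f^{(k)} (y)`. [cite: RotaKahanerOdlyzko1973, §13, p. 737] -/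
theorem iterate_derivative_taylor_one_sub_eval (f : K[X]) (k : ℕ) (y : K) :
    (derivative^[k] (taylor (1 : K) f - f)).eval y =
      (derivative^[k] f).eval (y + 1) - (derivative^[k] f).eval y := by
  rw [iterate_derivative_sub, iterate_derivative_taylor, eval_sub, taylor_eval]

/-- `J = ((e^D − 1)/D)` is invertible: its symbol has constant term `1`.
[cite: RotaKahanerOdlyzko1973, §13, p. 737] -/
theorem constantCoeff_bernoulliPowerSeries_inv_ne_zero :
    PowerSeries.constantCoeff (bernoulliPowerSeries K)⁻¹ ≠ 0 := by
  rw [PowerSeries.constantCoeff_inv, constantCoeff_bernoulliPowerSeries, inv_one]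
  exact one_ne_zero

/-- `J` preserves degrees. [cite: RotaKahanerOdlyzko1973, §13, p. 737] -/
theorem natDegree_diffOp_bernoulliPowerSeries_inv (f : K[X]) :
    (diffOp (bernoulliPowerSeries K)⁻¹ f).natDegree = f.natDegree :=
  natDegree_diffOp_eq (constantCoeff_bernoulliPowerSeries_inv_ne_zero K) f

/-- `J⁻¹ J = I` on a polynomial. [cite: RotaKahanerOdlyzko1973, §13, p. 737] -/
theorem diffOp_bernoulliPowerSeries_diffOp_inv (f : K[X]) :
    diffOp (bernoulliPowerSeries K) (diffOp (bernoulliPowerSeries K)⁻¹ f) = f := by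
  rw [← LinearMap.comp_apply, diffOp_comp_diffOp_inv (constantCoeff_bernoulliPowerSeries_ne_zero K),
    LinearMap.id_apply]

/-! ## `J⁻¹ = Σ_k B_k Dᵏ/k!`, the Second Expansion Theorem for `B_n`, and the Euler–Maclaurin formula -/

/-- `[tᵏ] (t/(e^t − 1)) = B_k/k!`. [cite: RotaKahanerOdlyzko1973, §13, p. 737] -/
theorem powerSeries_coeff_bernoulliPowerSeries (k : ℕ) :
    PowerSeries.coeff k (bernoulliPowerSeries K) = algebraMap ℚ K (bernoulli k) / (k.factorial : K) := by
  rw [bernoulliPowerSeries, PowerSeries.coeff_mk, map_div₀, map_natCast]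

/-- **`J⁻¹ = D/(e^D − 1) = Σ_k B_k Dᵏ/k!`** on polynomials (`N > deg f`).
[cite: RotaKahanerOdlyzko1973, §13 ("`J^{−1} xⁿ = B_n (x)`"), p. 737] -/
theorem diffOp_bernoulliPowerSeries_apply (f : K[X]) {N : ℕ} (hN : f.natDegree < N) :
    diffOp (bernoulliPowerSeries K) f =
      ∑ k ∈ range N, (algebraMap ℚ K (bernoulli k) / (k.factorial : K)) • derivative^[k] f := by
  rw [diffOp_apply _ f hN]
  exact sum_congr rfl fun k _ => by rw [powerSeries_coeff_bernoulliPowerSeries]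

/-- `B_k (0) = B_k` transported to `K`. [cite: RotaKahanerOdlyzko1973, §13, p. 737] -/
theorem bernoulli_map_eval_zero (k : ℕ) :
    ((Polynomial.bernoulli k).map (algebraMap ℚ K)).eval 0 = algebraMap ℚ K (bernoulli k) := by
  rw [eval_map, eval₂_at_zero, ← Polynomial.bernoulli_eval_zero, eval, eval₂_at_zero, RingHom.id_apply]

/-- **The Second Expansion Theorem for the Bernoulli polynomials** (`Q = D`, `S⁻¹ = J`):
`E^y g = Σ_{k<N} (Dᵏ J g)(y)/k! · B_k (x)`, i.e. `g (x + y) = Σ_k B_k (x)/k! · ∫_y^{y+1} g^{(k)}`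
(`N > deg g`). [cite: RotaKahanerOdlyzko1973, §5 Theorem 6, p. 699] [cite: RotaKahanerOdlyzko1973, §13
("The second expansion theorem yields the Euler–MacLaurin sum formula"), p. 737] -/
theorem taylor_eq_sum_bernoulli (g : K[X]) (y : K) {N : ℕ} (hN : g.natDegree < N) :
    taylor y g = ∑ k ∈ range N,
      ((derivative^[k] (diffOp (bernoulliPowerSeries K)⁻¹ g)).eval y / (k.factorial : K)) •
        (Polynomial.bernoulli k).map (algebraMap ℚ K) := by
  have h := IsShefferSequence.taylor_map_eq_sum isDeltaOperator_derivative isBasicSequence_derivative_X_pow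
    (isShiftInvariant_diffOp (bernoulliPowerSeries K)) (fun n => (bernoulli_map_eq_diffOp_X_pow K n).symm)
    (diffOp (bernoulliPowerSeries K)⁻¹ g) y (N := N) (by rwa [natDegree_diffOp_bernoulliPowerSeries_inv])
  rw [diffOp_bernoulliPowerSeries_diffOp_inv] at h
  rw [h]
  exact sum_congr rfl fun k _ => by rw [Module.End.pow_apply]

/-- … evaluated at `x`: **`g (x + y) = Σ_{k<N} B_k (x)/k! · (Dᵏ J g)(y)`**.
[cite: RotaKahanerOdlyzko1973, §5 Theorem 6, p. 699] [cite: RotaKahanerOdlyzko1973, §13, p. 737] -/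
theorem eval_add_eq_sum_bernoulli (g : K[X]) (x y : K) {N : ℕ} (hN : g.natDegree < N) :
    g.eval (x + y) = ∑ k ∈ range N,
      ((Polynomial.bernoulli k).map (algebraMap ℚ K)).eval x / (k.factorial : K) *
        (derivative^[k] (diffOp (bernoulliPowerSeries K)⁻¹ g)).eval y := by
  have h := congrArg (eval x) (taylor_eq_sum_bernoulli K g y hN)
  rw [taylor_eval] at h
  rw [h, eval_finsetSum]
  exact sum_congr rfl fun k _ => by rw [eval_smul, smul_eq_mul]; ring

/-- **Euler–Maclaurin, operator form**: `f = Σ_{k<N} B_k/k! · Dᵏ J f` (`N > deg f`), i.e.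
`I = J⁻¹ J` with `J⁻¹` expanded. [cite: RotaKahanerOdlyzko1973, §13, p. 737] -/
theorem eq_sum_bernoulli_smul_iterate_derivative (f : K[X]) {N : ℕ} (hN : f.natDegree < N) :
    f = ∑ k ∈ range N, (algebraMap ℚ K (bernoulli k) / (k.factorial : K)) •
      derivative^[k] (diffOp (bernoulliPowerSeries K)⁻¹ f) := by
  conv_lhs => rw [← diffOp_bernoulliPowerSeries_diffOp_inv K f]
  exact diffOp_bernoulliPowerSeries_apply K _ (by rwa [natDegree_diffOp_bernoulliPowerSeries_inv])

/-- **The Euler–Maclaurin formula for a polynomial (one step)**: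
`f = J f + Σ_{k<N} B_{k+1}/(k+1)! · Dᵏ (f (x+1) − f (x))` (`N > deg f`; `B_1 = −1/2`).
[cite: RotaKahanerOdlyzko1973, §13 ("The second expansion theorem yields the Euler–MacLaurin sum
formula"), p. 737] -/
theorem eulerMaclaurin_one_step (f : K[X]) {N : ℕ} (hN : f.natDegree < N) :
    f = diffOp (bernoulliPowerSeries K)⁻¹ f + ∑ k ∈ range N,
      (algebraMap ℚ K (bernoulli (k + 1)) / ((k + 1).factorial : K)) •
        derivative^[k] (taylor (1 : K) f - f) := by
  have h := eq_sum_bernoulli_smul_iterate_derivative K f (N := N + 1) (by omega)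
  rw [sum_range_succ', _root_.bernoulli_zero, map_one, Nat.factorial_zero, Nat.cast_one, div_one, one_smul,
    Function.iterate_zero_apply] at h
  calc f = _ := h
    _ = _ := by
      rw [add_comm]
      congr 1
      exact sum_congr rfl fun k _ => by rw [iterate_derivative_succ_diffOp_bernoulliPowerSeries_inv]

/-- **The Euler–Maclaurin formula for a polynomial, evaluated**: with `F′ = f`,
`f (y) = (F (y+1) − F (y)) + Σ_{k<N} B_{k+1}/(k+1)! · (f^{(k)} (y+1) − f^{(k)} (y))`, i.e.
`f (y) = ∫_y^{y+1} f + Σ_{k≥1} B_k/k! · (f^{(k−1)} (y+1) − f^{(k−1)} (y))`.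
[cite: RotaKahanerOdlyzko1973, §13, p. 737] -/
theorem eulerMaclaurin_eval {f F : K[X]} (hF : derivative F = f) (y : K) {N : ℕ} (hN : f.natDegree < N) :
    f.eval y = (F.eval (y + 1) - F.eval y) + ∑ k ∈ range N,
      algebraMap ℚ K (bernoulli (k + 1)) / ((k + 1).factorial : K) *
        ((derivative^[k] f).eval (y + 1) - (derivative^[k] f).eval y) := by
  have h := congrArg (eval y) (eulerMaclaurin_one_step K f hN)
  rw [eval_add, eval_finsetSum] at h
  rw [h, ← hF, diffOp_bernoulliPowerSeries_inv_derivative_eval, hF]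
  congr 1
  exact sum_congr rfl fun k _ => by
    rw [eval_smul, smul_eq_mul, iterate_derivative_taylor_one_sub_eval]

/-- **The Euler–Maclaurin sum formula for polynomials** (exact): with `F′ = f` and `N > deg f`,
`Σ_{i=0}^{m−1} f (i) = F (m) − F (0) + Σ_{k<N} B_{k+1}/(k+1)! · (f^{(k)} (m) − f^{(k)} (0))`
(`B_1 = −1/2`, so the `k = 0` term is `−(f (m) − f (0))/2`).
[cite: RotaKahanerOdlyzko1973, §13 ("The second expansion theorem yields the Euler–MacLaurin sum
formula"), p. 737] -/
theorem eulerMaclaurin_sum_range {f F : K[X]} (hF : derivative F = f) (m : ℕ) {N : ℕ} (hN : f.natDegree < N) :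
    ∑ i ∈ range m, f.eval (i : K) = F.eval (m : K) - F.eval 0 + ∑ k ∈ range N,
      algebraMap ℚ K (bernoulli (k + 1)) / ((k + 1).factorial : K) *
        ((derivative^[k] f).eval (m : K) - (derivative^[k] f).eval 0) := by
  have hstep : ∀ i : ℕ, f.eval (i : K) = (F.eval ((i + 1 : ℕ) : K) - F.eval (i : K)) + ∑ k ∈ range N,
      algebraMap ℚ K (bernoulli (k + 1)) / ((k + 1).factorial : K) *
        ((derivative^[k] f).eval ((i + 1 : ℕ) : K) - (derivative^[k] f).eval (i : K)) := fun i => by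
    rw [Nat.cast_succ]
    exact eulerMaclaurin_eval K hF (i : K) hN
  rw [sum_congr rfl fun i _ => hstep i, sum_add_distrib, Finset.sum_range_sub (fun i => F.eval (i : K)),
    Nat.cast_zero, sum_comm]
  congr 1
  refine sum_congr rfl fun k _ => ?_
  rw [← mul_sum, Finset.sum_range_sub (fun i => (derivative^[k] f).eval (i : K)), Nat.cast_zero]

/-! ## The mean operator `M = I + Δ/2`, the Euler polynomials `E_n = M⁻¹ xⁿ`, and Boole's summation formula -/

/-- **`M = I + Δ/2 = ½ (e^D + I)` acts as `(M f)(y) = ½ (f (y) + f (y + 1))`.**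
[cite: RotaKahanerOdlyzko1973, §13 ("`E_n^{(a)} (x) = [I + (Δ/2)]^{−a} xⁿ`"), p. 737] -/
theorem diffOp_half_exp_add_one_apply (f : K[X]) :
    diffOp ((2⁻¹ : K) • (PowerSeries.exp K + 1)) f = (2⁻¹ : K) • (f + taylor (1 : K) f) := by
  rw [diffOp_smul, LinearMap.smul_apply, diffOp_exp_add_one, LinearMap.add_apply, LinearMap.id_apply,
    add_comm]

/-- `(M f)(y) = ½ (f (y) + f (y+1))`. [cite: RotaKahanerOdlyzko1973, §13, p. 737] -/
theorem diffOp_half_exp_add_one_eval (f : K[X]) (y : K) :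
    (diffOp ((2⁻¹ : K) • (PowerSeries.exp K + 1)) f).eval y = 2⁻¹ * (f.eval y + f.eval (y + 1)) := by
  rw [diffOp_half_exp_add_one_apply, eval_smul, eval_add, taylor_eval, smul_eq_mul]

/-- `(Dᵏ M f)(y) = ½ (f^{(k)} (y) + f^{(k)} (y+1))` (`M` commutes with `D`).
[cite: RotaKahanerOdlyzko1973, §13, p. 737] -/
theorem iterate_derivative_diffOp_half_exp_add_one_eval (f : K[X]) (k : ℕ) (y : K) :
    (derivative^[k] (diffOp ((2⁻¹ : K) • (PowerSeries.exp K + 1)) f)).eval y =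
      2⁻¹ * ((derivative^[k] f).eval y + (derivative^[k] f).eval (y + 1)) := by
  rw [diffOp_half_exp_add_one_apply, iterate_derivative_smul, iterate_map_add, iterate_derivative_taylor, eval_smul,
    eval_add, taylor_eval, smul_eq_mul]

/-- **`E_n = M⁻¹ xⁿ`**: `M⁻¹ = (½ (e^D + I))⁻¹ = 2 (e^D + I)⁻¹`.
[cite: RotaKahanerOdlyzko1973, §13 ("`E_n (x) = [I + (Δ/2)]^{−1} xⁿ`"), p. 737] -/
theorem two_smul_exp_add_one_inv :
    ((2 : K) • (PowerSeries.exp K + 1)⁻¹ : PowerSeries K) = ((2⁻¹ : K) • (PowerSeries.exp K + 1))⁻¹ := by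
  rw [PowerSeries.smul_inv, inv_inv]

/-- `½ (e^t + 1)` has constant term `1 ≠ 0`. [cite: RotaKahanerOdlyzko1973, §13, p. 737] -/
theorem constantCoeff_half_exp_add_one_ne_zero :
    PowerSeries.constantCoeff ((2⁻¹ : K) • (PowerSeries.exp K + 1)) ≠ 0 := by
  rw [PowerSeries.smul_eq_C_mul, map_mul, PowerSeries.constantCoeff_C, constantCoeff_exp_add_one,
    inv_mul_cancel₀ (two_ne_zero' K)]
  exact one_ne_zero

/-- `M⁻¹ M = I` on a polynomial. [cite: RotaKahanerOdlyzko1973, §13, p. 737] -/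
theorem diffOp_two_smul_inv_diffOp_half (f : K[X]) :
    diffOp ((2 : K) • (PowerSeries.exp K + 1)⁻¹) (diffOp ((2⁻¹ : K) • (PowerSeries.exp K + 1)) f) = f := by
  rw [two_smul_exp_add_one_inv, ← LinearMap.comp_apply,
    diffOp_inv_comp_diffOp (constantCoeff_half_exp_add_one_ne_zero K), LinearMap.id_apply]

/-- `M` preserves degrees. [cite: RotaKahanerOdlyzko1973, §13, p. 737] -/
theorem natDegree_diffOp_half_exp_add_one (f : K[X]) :
    (diffOp ((2⁻¹ : K) • (PowerSeries.exp K + 1)) f).natDegree = f.natDegree :=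
  natDegree_diffOp_eq (constantCoeff_half_exp_add_one_ne_zero K) f

/-- **The Second Expansion Theorem for the Euler polynomials** (`Q = D`, `S = M = I + Δ/2`):
`E^y g = Σ_{k<N} (Dᵏ M g)(y)/k! · E_k (x)` (`N > deg g`).
[cite: RotaKahanerOdlyzko1973, §5 Theorem 6, p. 699] [cite: RotaKahanerOdlyzko1973, §13 ("The second
expansion theorem applied to the Euler polynomials yields the Boole summation formula"), p. 738] -/
theorem taylor_eq_sum_eulerPolynomial (g : K[X]) (y : K) {N : ℕ} (hN : g.natDegree < N) :
    taylor y g = ∑ k ∈ range N,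
      ((derivative^[k] (diffOp ((2⁻¹ : K) • (PowerSeries.exp K + 1)) g)).eval y / (k.factorial : K)) •
        eulerPolynomial K k := by
  have h := IsShefferSequence.taylor_map_eq_sum isDeltaOperator_derivative isBasicSequence_derivative_X_pow
    (isShiftInvariant_diffOp ((2 : K) • (PowerSeries.exp K + 1)⁻¹)) (fun n => (eulerPolynomial_eq K n).symm)
    (diffOp ((2⁻¹ : K) • (PowerSeries.exp K + 1)) g) y (N := N) (by rwa [natDegree_diffOp_half_exp_add_one])
  rw [diffOp_two_smul_inv_diffOp_half] at h
  rw [h]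
  exact sum_congr rfl fun k _ => by rw [Module.End.pow_apply]

/-- **Boole's formula for a polynomial**: `g (x + y) = Σ_{k<N} E_k (x)/k! · ½ (g^{(k)} (y) + g^{(k)} (y+1))`.
[cite: RotaKahanerOdlyzko1973, §5 Theorem 6, p. 699] [cite: RotaKahanerOdlyzko1973, §13, p. 738] -/
theorem eval_add_eq_sum_eulerPolynomial (g : K[X]) (x y : K) {N : ℕ} (hN : g.natDegree < N) :
    g.eval (x + y) = ∑ k ∈ range N, (eulerPolynomial K k).eval x / (k.factorial : K) *
      (2⁻¹ * ((derivative^[k] g).eval y + (derivative^[k] g).eval (y + 1))) := by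
  have h := congrArg (eval x) (taylor_eq_sum_eulerPolynomial K g y hN)
  rw [taylor_eval] at h
  rw [h, eval_finsetSum]
  exact sum_congr rfl fun k _ => by
    rw [eval_smul, smul_eq_mul, iterate_derivative_diffOp_half_exp_add_one_eval]; ring

/-- An alternating sum of consecutive-pair sums telescopes:
`Σ_{i<m} (−1)^i (a_i + a_{i+1}) = a_0 − (−1)^m a_m`. [cite: RotaKahanerOdlyzko1973, §13, p. 738] -/
theorem alternating_sum_range_add_succ {R : Type*} [CommRing R] (a : ℕ → R) (m : ℕ) :
    ∑ i ∈ range m, (-1) ^ i * (a i + a (i + 1)) = a 0 - (-1) ^ m * a m := by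
  induction m with
  | zero => simp
  | succ m ih => rw [sum_range_succ, ih, pow_succ]; ring

/-- **The Boole summation formula for polynomials** (exact): for `N > deg f`,
`Σ_{i=0}^{m−1} (−1)^i f (i) = ½ Σ_{k<N} E_k (0)/k! · (f^{(k)} (0) − (−1)^m f^{(k)} (m))`.
[cite: RotaKahanerOdlyzko1973, §13 ("The second expansion theorem applied to the Euler polynomials
yields the Boole summation formula"), p. 738] -/
theorem boole_sum_range (f : K[X]) (m : ℕ) {N : ℕ} (hN : f.natDegree < N) :
    ∑ i ∈ range m, (-1) ^ i * f.eval (i : K) = 2⁻¹ * ∑ k ∈ range N,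
      (eulerPolynomial K k).eval 0 / (k.factorial : K) *
        ((derivative^[k] f).eval 0 - (-1) ^ m * (derivative^[k] f).eval (m : K)) := by
  have hstep : ∀ i : ℕ, f.eval (i : K) = ∑ k ∈ range N, (eulerPolynomial K k).eval 0 / (k.factorial : K) *
      (2⁻¹ * ((derivative^[k] f).eval (i : K) + (derivative^[k] f).eval ((i + 1 : ℕ) : K))) := fun i => by
    rw [Nat.cast_succ, ← eval_add_eq_sum_eulerPolynomial K f 0 (i : K) hN, zero_add]
  calc ∑ i ∈ range m, (-1) ^ i * f.eval (i : K)
      = ∑ i ∈ range m, ∑ k ∈ range N, (-1) ^ i * ((eulerPolynomial K k).eval 0 / (k.factorial : K) *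
          (2⁻¹ * ((derivative^[k] f).eval (i : K) + (derivative^[k] f).eval ((i + 1 : ℕ) : K)))) :=
        sum_congr rfl fun i _ => by rw [hstep i, mul_sum]
    _ = ∑ k ∈ range N, ∑ i ∈ range m, (-1) ^ i * ((eulerPolynomial K k).eval 0 / (k.factorial : K) *
          (2⁻¹ * ((derivative^[k] f).eval (i : K) + (derivative^[k] f).eval ((i + 1 : ℕ) : K)))) := sum_comm
    _ = _ := by
        rw [mul_sum]
        refine sum_congr rfl fun k _ => ?_
        have h := alternating_sum_range_add_succ (fun i : ℕ => (derivative^[k] f).eval (i : K)) m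
        beta_reduce at h
        rw [Nat.cast_zero] at h
        rw [← h, mul_sum, mul_sum]
        exact sum_congr rfl fun i _ => by ring

end Literature.Algebra.Polynomial
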